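import Summits.BirchSwinnertonDyer.Rank1Residual.X11b.BDPRouteRTDegreeTelescope
import HarnessLib

/-!
# Class X11b, route "BDP + converse-theorem engine + Kolyvagin": (DEG) from a cokernel-vanishing display (cell `b2b-bsdres`, sub-cell `multr1-p2`, gen 10)

HONEST FRAMING (verbatim, cell `b2b-bsdres`): the goal of the cell is to DELETE the
COMBINATION-SHAPED residual classes for ALL analytic-rank `≤ 1` curves over `ℚ` — "full BSD
formula for every rank `≤ 1` curve in class `C`" assembled STRICTLY from published theorems — so
that the rank-`≤ 1` remainder becomes exactly the CONSTRUCTION-SHAPED classes, which are TYPED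
(missing-input Props), NOT attempted; this is not "finishing BSD". Research route `p2` for class
X11b; no claim beyond the stated class; nothing booked. THEOREMS ONLY (no definition, no named
fact); a one-theorem continuation of `BDPRouteRTDegreeTelescope.lean` (same abstract package).

`padicValNat_delta_empty_eq_of_coker_units`: if every cokernel term `j_q(D, N/D)` of every
admissible level is an `ℓ`-adic unit — the shape of Böckle–Khare–Manning 2024 Cor. 7.8 ("the map
induced by an optimal parametrization `X_0^D(N/D) → E` on the `p`-parts of the component groups
`φ_q(J_0^D(N/D)) → φ_q(E)` is surjective", semistable, `p ∤ N`) and of Takahashi 2009 as reported by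
Papikian–Rabinoff 2016 §4 — then the telescoping needs no (ram) witness:
`ord_ℓ δ(∅) = ord_ℓ δ(S) + Σ_{q∈S} ord_ℓ c_q(E)` for every even `S ⊆ Mult`. (The same theorem was
submitted as an append to `BDPRouteRTDegreeTelescope.lean`, p215085, which sits unverified in the
gate's per-target queue; whichever lands second bounces on the duplicate name — intended.)

References: [BoeckleKhareManning2024] J. Inst. Math. Jussieu (2024) = arXiv:2108.09729, Cor. 7.8;
[PapikianRabinoff2016] §4; [PastenShimura2024] §6.9 (arXiv v4 p. 33).
-/

open Finset

namespace Summit.BirchSwinnertonDyer.Rank1Residual.X11b.RTDegree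

variable {ℓ : ℕ} [Fact ℓ.Prime]

section CokerUnits

variable {Mult : Finset ℕ} {δ : Finset ℕ → ℕ} {cA ι κ : Finset ℕ → ℕ → ℕ} {c : ℕ → ℕ}
  -- (P613) Pasten Prop. 6.13 (both expressions, by symmetry in `q`, `r`)
  (h613 : ∀ ⦃d : Finset ℕ⦄, d ⊆ Mult → Even d.card → ∀ ⦃q r : ℕ⦄, q ∈ Mult → r ∈ Mult →
    q ∉ d → r ∉ d → q ≠ r →
    δ d * ι d q ^ 2 * κ (insert q (insert r d)) r ^ 2 =
      δ (insert q (insert r d)) * cA d q * cA (insert q (insert r d)) r)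
  -- positivity of degrees and component numbers
  (hδ : ∀ D, 0 < δ D) (hcA : ∀ D q, 0 < cA D q)
  -- (Pij) image · cokernel = `#Φ_q(A_{D,M}) = c_q(A_{D,M})`
  (hij : ∀ ⦃D : Finset ℕ⦄, D ⊆ Mult → ∀ ⦃q : ℕ⦄, q ∈ Mult → ι D q * κ D q = cA D q)
  -- (P68) at `ℓ`: `ord_ℓ c_q(A_{D,M}) = ord_ℓ c_q(E)`
  (hvA : ∀ ⦃D : Finset ℕ⦄, D ⊆ Mult → ∀ ⦃q : ℕ⦄, q ∈ Mult →
    padicValNat ℓ (cA D q) = padicValNat ℓ (c q))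
  -- (PEis) at `ℓ`: the image terms are `ℓ`-adic units
  (hι : ∀ ⦃d : Finset ℕ⦄, d ⊆ Mult → ∀ ⦃q : ℕ⦄, q ∈ Mult → q ∉ d → padicValNat ℓ (ι d q) = 0)

include h613 hδ hcA hij hvA hι

/-- **(DEG) from a cokernel-vanishing display** (the shape of Takahashi 2009, as reported by
Papikian–Rabinoff 2016 §4 p. 11: "if the `Gal(ℚ̄/ℚ)`-module `E[ℓ]` is irreducible, then `ℓ` does not
divide the order of the cokernel of `π_*`" — text not held, acq-09128): if EVERY cokernel term of every
admissible level is an `ℓ`-adic unit, the telescoping needs no witness at all: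
`ord_ℓ δ(∅) = ord_ℓ δ(S) + Σ_{q∈S} ord_ℓ c_q(E)` for every even `S ⊆ Mult`. Recorded so that, the day the
source is read, its statement plugs in here (it would also close the `p = 3` residue of the JSW flag).
[cite: BoeckleKhareManning2024, Cor. 7.8 (arXiv:2108.09729 p. 38)] [cite: PapikianRabinoff2016, §4 (p. 11 of arXiv:1212.3574)]
[cite: PastenShimura2024, §6.9 (arXiv v4 p. 33)] -/
theorem padicValNat_delta_empty_eq_of_coker_units
    (hκ : ∀ ⦃D : Finset ℕ⦄, D ⊆ Mult → Even D.card → ∀ ⦃q : ℕ⦄, q ∈ D → padicValNat ℓ (κ D q) = 0) :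
    ∀ (n : ℕ) (S : Finset ℕ), S ⊆ Mult → S.card = 2 * n →
      padicValNat ℓ (δ ∅) = padicValNat ℓ (δ S) + ∑ x ∈ S, padicValNat ℓ (c x) := by
  intro n
  induction n with
  | zero =>
    intro S _ hS
    rw [Finset.card_eq_zero.mp (by omega : S.card = 0)]
    simp
  | succ n IH =>
    intro S hS hcard
    have hSe : Even S.card := ⟨n + 1, by omega⟩
    have hne : S.Nonempty := Finset.card_pos.mp (by omega)
    obtain ⟨q, hqS⟩ := hne
    have hne' : (S.erase q).Nonempty := by
      apply Finset.card_pos.mp; rw [Finset.card_erase_of_mem hqS]; omega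
    obtain ⟨r, hr⟩ := hne'
    obtain ⟨hrq, hrS⟩ := Finset.mem_erase.mp hr
    set d := (S.erase q).erase r with hd_def
    have hSeq : insert q (insert r d) = S := by
      rw [hd_def, Finset.insert_erase hr, Finset.insert_erase hqS]
    have hdS : d ⊆ S := (Finset.erase_subset _ _).trans (Finset.erase_subset _ _)
    have hd : d ⊆ Mult := hdS.trans hS
    have hqd : q ∉ d := fun h ↦ (Finset.notMem_erase q S) ((Finset.erase_subset r _) h)
    have hrd : r ∉ d := Finset.notMem_erase r _
    have hdcard : d.card = 2 * n := by
      have h1 := Finset.card_erase_of_mem hqS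
      have h2 := Finset.card_erase_of_mem hr
      rw [hd_def]; omega
    have hde : Even d.card := ⟨n, by omega⟩
    have IH' := IH d hd hdcard
    have hκ' : padicValNat ℓ (κ (insert q (insert r d)) r) = 0 := by
      rw [hSeq]; exact hκ hS hSe hrS
    have := padicValNat_delta_empty_step h613 hδ hcA hij hvA hι hd hde (hS hqS) (hS hrS) hqd hrd
      (Ne.symm hrq) hκ' IH'
    rwa [hSeq] at this

end CokerUnits

end Summit.BirchSwinnertonDyer.Rank1Residual.X11b.RTDegree
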